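import Literature.NumberTheory.DiophantineApproximation.ApproximationByAlgebraicNumbers
import Literature.NumberTheory.DiophantineApproximation.IntegerPolynomialRootDistance
import Literature.NumberTheory.DiophantineApproximation.IntegerPolynomialSmallValue
import Mathlib.RingTheory.Polynomial.GaussLemma
import Mathlib.RingTheory.Polynomial.Content
import Mathlib.FieldTheory.Separable
import HarnessLib

/-!
# Approximation by algebraic numbers of bounded degree and Mahler measure: the proof
# (discharge of `Bugeaud2004_thm_8_11`)

Topic `Literature/NumberTheory/DiophantineApproximation`; sibling proof file of
`ApproximationByAlgebraicNumbers.lean`, which states the named fact `Bugeaud2004_thm_8_11`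
(Y. Bugeaud, *Approximation by Algebraic Numbers*, CUP 2004, **Theorem 8.11**, PDF p. 184, due to
G. Diaz 1997): for `ξ ∈ ℂ`, `n ≥ 50`, `M ≥ n + 1`, `M ≥ (4 + |ξ|)^{100}` there is an algebraic `α`
with `deg α ≤ n`, `M(α) ≤ M` and `|ξ - α| ≤ exp{-(6/1000)(n log M(α) + deg(α) log M)}`. Here we
prove `theorem Bugeaud2004_thm_8_11_holds : Bugeaud2004_thm_8_11`, kept in a separate module so
that the fact file does not acquire the resultant / Hadamard / pigeonhole imports.

## The argument (Bugeaud's proof, PDF pp. 184–185, "following step by step Diaz [188]")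

1. (`IntegerPolynomialSmallValue.lean`, Lemma 8.1 with
   `H := M (n+1)^{-1/2} ≥ M^{1/2} ≥ (4+|ξ|)^{50}`) a non-zero `P₀ ∈ ℤ[X]`, `deg P₀ ≤ n`,
   `H(P₀) ≤ H`, `|P₀(ξ)| ≤ exp(-0.455 n log H)`;
2. Landau's inequality (Bugeaud Lemma A.2, Mathlib
   `Polynomial.mahlerMeasure_le_sqrt_natDegree_add_one_mul_supNorm`): `M(P₀) ≤ √(n+1) H = M`, and
   `log H ≥ ½ log M` gives (8.21) `|P₀(ξ)| ≤ exp(-0.2275 n log M)`;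
3. the averaging step (8.22) over the irreducible factorisation of `P₀`, organised as an induction
   on irreducible factors (`WfDvdMonoid.induction_on_irreducible`) with the multiplicative weight
   `w(Q) = exp{-0.113 (deg Q log M + n log M(Q))}`: since
   `|P₀(ξ)| < exp(-0.226 n log M) ≤ w(P₀)`, some irreducible factor `q` of positive degree has
   `|q(ξ)| < w(q)` (constant factors have `|q(ξ)| ≥ 1 ≥ w(q)`) —
   `exists_irreducible_factor_lt_weight`;
4. `q_ℂ` is separable (Gauss's lemma + characteristic `0`), so Lemma A.8 (A.25)
   (`IntegerPolynomialRootDistance.lean`, `norm_sub_root_pow_le`, squared form) applies at the root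
   `α` of `q` nearest to `ξ`, with `ℓ = 18`;
5. with `deg q ≤ n < M`, `1 ≤ M(q) ≤ M(P₀) ≤ M` and `log 2 ≤ (log M)/200` this gives
   `|ξ - α|^{342} ≤ exp{-2.052 (n log M(α) + deg(α) log M)}` (the square of the printed
   `|ξ - α|^{171} ≤ exp{-1.034 (deg(α) log M + n log M(α))}`), and `2.052/342 = 6/1000`.
The output is `(α, q)` with `q` irreducible in `ℤ[X]` vanishing at `α`, as the fact demands.

## Contents
* `weight_mul`, `exists_irreducible_factor_lt_weight` — step 3 (the weight is written out).
* `one_le_mahlerMeasure_map`, `mahlerMeasure_map_le_of_dvd`, `separable_map_of_irreducible`.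
* `exists_int_poly_mahlerMeasure_le` (steps 1–2), `dist_le_of_root_distance_bound` (step 5),
  `Bugeaud2004_thm_8_11_holds` — the discharge.
-/

namespace Literature.NumberTheory.DiophantineApproximation

open Polynomial Finset

/-- `1 ≤ M(Q)` for a non-zero integer polynomial `Q`. This is Mathlib's
`Polynomial.one_le_mahlerMeasure_of_ne_zero` with the polynomial explicit (dedup-01095: kept as a
one-line restatement because Summits files use this name and argument order). [folklore] -/
theorem one_le_mahlerMeasure_map (Q : ℤ[X]) (hQ : Q ≠ 0) :
    1 ≤ (Q.map (Int.castRingHom ℂ)).mahlerMeasure :=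
  one_le_mahlerMeasure_of_ne_zero hQ

/-- Multiplicativity of the weight `w(Q) = exp{-0.113 (deg Q · log M + n · log M(Q))}` of the
averaging step (8.22) in the proof of Bugeaud's Theorem 8.11. [cite: Bugeaud2004, Thm 8.11 proof] -/
theorem weight_mul (n : ℕ) (M : ℝ) {Q R : ℤ[X]} (hQ : Q ≠ 0) (hR : R ≠ 0) :
    Real.exp (-(113 / 1000) * ((Q * R).natDegree * Real.log M +
        n * Real.log ((Q * R).map (Int.castRingHom ℂ)).mahlerMeasure)) =
      Real.exp (-(113 / 1000) * (Q.natDegree * Real.log M +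
        n * Real.log (Q.map (Int.castRingHom ℂ)).mahlerMeasure)) *
      Real.exp (-(113 / 1000) * (R.natDegree * Real.log M +
        n * Real.log (R.map (Int.castRingHom ℂ)).mahlerMeasure)) := by
  rw [← Real.exp_add, natDegree_mul hQ hR, Polynomial.map_mul, mahlerMeasure_mul,
    Real.log_mul (mahlerMeasure_pos_of_ne_zero (by simpa using
        (Polynomial.map_ne_zero_iff (Int.cast_injective (α := ℂ))).2 hQ)).ne'
      (mahlerMeasure_pos_of_ne_zero (by simpa using
        (Polynomial.map_ne_zero_iff (Int.cast_injective (α := ℂ))).2 hR)).ne']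
  push_cast
  ring_nf

/-- **Averaging step** of the proof of Bugeaud's Theorem 8.11: if a non-zero integer polynomial
`Q` satisfies `|Q(ξ)| < w(Q)`, then some irreducible factor `q` of `Q` of
positive degree satisfies `|q(ξ)| < w(q)` (constant irreducible factors have `|q(ξ)| ≥ 1 ≥ w(q)`,
and `w` is multiplicative). [cite: Bugeaud2004, Thm 8.11 proof (8.22)] -/
theorem exists_irreducible_factor_lt_weight (ξ : ℂ) (n : ℕ) (M : ℝ) (Q : ℤ[X]) :
    Q ≠ 0 → ‖aeval ξ Q‖ < Real.exp (-(113 / 1000) * (Q.natDegree * Real.log M +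
        n * Real.log (Q.map (Int.castRingHom ℂ)).mahlerMeasure)) →
      ∃ q : ℤ[X], Irreducible q ∧ q ∣ Q ∧ 0 < q.natDegree ∧
        ‖aeval ξ q‖ < Real.exp (-(113 / 1000) * (q.natDegree * Real.log M +
          n * Real.log (q.map (Int.castRingHom ℂ)).mahlerMeasure)) := by
  -- the weight `w`
  set w : ℤ[X] → ℝ := fun Q => Real.exp (-(113 / 1000) * (Q.natDegree * Real.log M +
      n * Real.log (Q.map (Int.castRingHom ℂ)).mahlerMeasure)) with hw
  change Q ≠ 0 → ‖aeval ξ Q‖ < w Q → ∃ q : ℤ[X], Irreducible q ∧ q ∣ Q ∧ 0 < q.natDegree ∧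
    ‖aeval ξ q‖ < w q
  induction Q using WfDvdMonoid.induction_on_irreducible with
  | zero => intro h; exact absurd rfl h
  | unit u hu =>
    intro _ hlt
    exfalso
    obtain ⟨r, hr, rfl⟩ := Polynomial.isUnit_iff.1 hu
    obtain ⟨s, rfl⟩ := hr
    have hs : (s : ℤ) = 1 ∨ (s : ℤ) = -1 := Int.isUnit_iff.1 s.isUnit
    have h1 : ‖aeval ξ (C (s : ℤ))‖ = 1 := by
      rw [aeval_C, algebraMap_int_eq, eq_intCast, Complex.norm_intCast]
      rcases hs with h | h <;> simp [h]
    have h2 : w (C (s : ℤ)) = 1 := by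
      rw [hw]
      dsimp only
      rw [natDegree_C, Polynomial.map_C, mahlerMeasure_const, eq_intCast, Complex.norm_intCast]
      rcases hs with h | h <;> simp [h]
    rw [h1, h2] at hlt
    exact lt_irrefl _ hlt
  | mul a i ha hi ih =>
    intro _ hlt
    have hi0 : i ≠ 0 := hi.ne_zero
    have hmul : w (i * a) = w i * w a := weight_mul n M hi0 ha
    rw [map_mul, norm_mul, hmul] at hlt
    have hwpos : ∀ R : ℤ[X], 0 < w R := fun R => Real.exp_pos _
    -- one of the two factors is below its weight
    by_cases hcase : ‖aeval ξ a‖ < w a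
    · obtain ⟨q, hq, hqa, hdeg, hqlt⟩ := ih ha hcase
      exact ⟨q, hq, hqa.trans (dvd_mul_left a i), hdeg, hqlt⟩
    · push Not at hcase
      have hilt : ‖aeval ξ i‖ < w i := by
        by_contra h
        push Not at h
        have := mul_le_mul h hcase (hwpos a).le (norm_nonneg _)
        linarith
      refine ⟨i, hi, dvd_mul_right i a, ?_, hilt⟩
      -- a constant irreducible factor cannot be below its weight
      by_contra hdeg
      push Not at hdeg
      have hdeg0 : i.natDegree = 0 := Nat.le_zero.1 hdeg
      obtain ⟨c, hc⟩ : ∃ c, i = C c := ⟨_, eq_C_of_natDegree_eq_zero hdeg0⟩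
      have hc0 : c ≠ 0 := by rintro rfl; simp [hc] at hi0
      have h1 : (1 : ℝ) ≤ ‖aeval ξ i‖ := by
        rw [hc, aeval_C, algebraMap_int_eq, eq_intCast, Complex.norm_intCast]
        exact_mod_cast Int.one_le_abs hc0
      have h2 : w i ≤ 1 := by
        rw [hw]
        dsimp only
        rw [hdeg0, Nat.cast_zero, zero_mul, zero_add, Real.exp_le_one_iff, neg_mul]
        apply neg_nonpos.2
        apply mul_nonneg (by norm_num)
        exact mul_nonneg (Nat.cast_nonneg _) (Real.log_nonneg (one_le_mahlerMeasure_map i hi0))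
      linarith

/-- The image in `ℂ[X]` of an irreducible integer polynomial of positive degree is separable
(Gauss's lemma and characteristic zero). [folklore] -/
theorem separable_map_of_irreducible (q : ℤ[X]) (hq : Irreducible q) (hdeg : 0 < q.natDegree) :
    (q.map (Int.castRingHom ℂ)).Separable := by
  have hprim : q.IsPrimitive := hq.isPrimitive hdeg.ne'
  have hirrQ : Irreducible (q.map (Int.castRingHom ℚ)) :=
    (IsPrimitive.Int.irreducible_iff_irreducible_map_cast hprim).1 hq
  have hsepQ : (q.map (Int.castRingHom ℚ)).Separable := hirrQ.separable
  rw [map_intCast_complex_eq_map_map]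
  exact hsepQ.map

/-- The Mahler measure of a factor of a non-zero integer polynomial is at most that of the
polynomial. [folklore] -/
theorem mahlerMeasure_map_le_of_dvd {q Q : ℤ[X]} (hqQ : q ∣ Q) (hQ : Q ≠ 0) :
    (q.map (Int.castRingHom ℂ)).mahlerMeasure ≤ (Q.map (Int.castRingHom ℂ)).mahlerMeasure := by
  obtain ⟨r, rfl⟩ := hqQ
  have hr : r ≠ 0 := right_ne_zero_of_mul hQ
  rw [Polynomial.map_mul, mahlerMeasure_mul]
  exact le_mul_of_one_le_right (mahlerMeasure_nonneg _) (one_le_mahlerMeasure_map r hr)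

/-- **Steps 1–2 of the proof of Bugeaud's Theorem 8.11**: Lemma 8.1 with `H = M (n+1)^{-1/2}`
and Landau's inequality give a non-zero `P₀ ∈ ℤ[X]` with `deg P₀ ≤ n`, `M(P₀) ≤ M` and
(8.21) `|P₀(ξ)| ≤ exp(-0.2275 n log M)`. [cite: Bugeaud2004, Thm 8.11 proof (8.21)] -/
theorem exists_int_poly_mahlerMeasure_le (ξ : ℂ) (n : ℕ) (M : ℝ) (hn : 50 ≤ n)
    (hnM : (n : ℝ) + 1 ≤ M) (hξM : (4 + ‖ξ‖) ^ 100 ≤ M) :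
    ∃ P₀ : ℤ[X], P₀ ≠ 0 ∧ P₀.natDegree ≤ n ∧
      (P₀.map (Int.castRingHom ℂ)).mahlerMeasure ≤ M ∧
      ‖aeval ξ P₀‖ ≤ Real.exp (-(2275 / 10000) * n * Real.log M) := by
  set A : ℝ := 4 + ‖ξ‖ with hA
  have hA4 : 4 ≤ A := by rw [hA]; linarith [norm_nonneg ξ]
  have hM4 : (4 : ℝ) ^ 100 ≤ M := le_trans (pow_le_pow_left₀ (by norm_num) hA4 100) hξM
  have hM0 : (0 : ℝ) < M := by linarith
  set LM := Real.log M with hLM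
  have hlogn : Real.log (n + 1) ≤ LM := Real.log_le_log (by positivity) hnM
  -- Lemma 8.1 with `H = M / √(n+1)`
  set H : ℝ := M / Real.sqrt (n + 1) with hH
  have hsq0 : 0 < Real.sqrt (n + 1) := Real.sqrt_pos.2 (by positivity)
  have hHA : A ^ 50 ≤ H := by
    have h1 : A ^ 50 ≤ Real.sqrt M := by
      rw [Real.le_sqrt (by positivity) hM0.le]
      calc (A ^ 50) ^ 2 = A ^ 100 := by ring
        _ ≤ M := hξM
    have h2 : Real.sqrt M ≤ H := by
      rw [hH, le_div_iff₀ hsq0]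
      calc Real.sqrt M * Real.sqrt (n + 1) ≤ Real.sqrt M * Real.sqrt M := by
            gcongr
        _ = M := Real.mul_self_sqrt hM0.le
    exact h1.trans h2
  have hlogH : LM / 2 ≤ Real.log H := by
    rw [hH, Real.log_div hM0.ne' hsq0.ne', Real.log_sqrt (by positivity)]
    linarith
  obtain ⟨P₀, hP₀0, hP₀deg, hP₀coeff, hP₀small⟩ := exists_int_poly_small_value ξ n hn H hHA
  set p₀ := P₀.map (Int.castRingHom ℂ) with hp₀
  -- Landau: `M(P₀) ≤ √(n+1) H(P₀) ≤ M`
  have hsup : p₀.supNorm ≤ H := by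
    obtain ⟨i, hi⟩ := p₀.exists_eq_supNorm
    rw [hi, hp₀, coeff_map, eq_intCast, Complex.norm_intCast]
    exact_mod_cast hP₀coeff i
  have hdegp₀ : p₀.natDegree ≤ n := (natDegree_map_le).trans hP₀deg
  have hMP₀ : p₀.mahlerMeasure ≤ M := by
    calc p₀.mahlerMeasure ≤ Real.sqrt (p₀.natDegree + 1) * p₀.supNorm :=
          mahlerMeasure_le_sqrt_natDegree_add_one_mul_supNorm p₀
      _ ≤ Real.sqrt (n + 1) * H := by
          have : (p₀.natDegree : ℝ) ≤ n := by exact_mod_cast hdegp₀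
          have hs0 := p₀.supNorm_nonneg
          gcongr
      _ = M := by rw [hH, mul_div_cancel₀ _ hsq0.ne']
  refine ⟨P₀, hP₀0, hP₀deg, hMP₀, hP₀small.trans (Real.exp_le_exp.2 ?_)⟩
  have k : (n : ℝ) * (LM / 2) ≤ n * Real.log H := mul_le_mul_of_nonneg_left hlogH (by positivity)
  linarith

/-- **Step 5 of the proof of Bugeaud's Theorem 8.11** (the numerical conclusion): from
Lemma A.8 (A.25)² with `ℓ = 18` for the factor `q` (`d = deg q ≤ n < M`, `1 ≤ M(q)`,
`M ≥ 2^{200}`) and (8.22) `|q(ξ)| ≤ exp{-0.113 (d log M + n log M(q))}` one gets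
`|ξ - α| ≤ exp{-(6/1000)(n log M(q) + d log M)}` (i.e. `|ξ-α|^{171} ≤ exp{-1.034(…)}`,
`1.034/171 ≥ 0.006`). [cite: Bugeaud2004, Thm 8.11 proof] -/
theorem dist_le_of_root_distance_bound (dmin Pq Mq M : ℝ) (d n : ℕ) (hdmin : 0 ≤ dmin)
    (hPq : 0 ≤ Pq) (hd1 : 1 ≤ d) (hdn : d ≤ n) (hnM : (n : ℝ) + 1 ≤ M) (hM2 : (2 : ℝ) ^ 200 ≤ M)
    (hMq1 : 1 ≤ Mq)
    (hqlt : Pq ≤ Real.exp (-(113 / 1000) * (d * Real.log M + n * Real.log Mq)))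
    (hA8 : dmin ^ (18 * (18 + 1)) ≤
      2 ^ (2 * d * 18) * (d : ℝ) ^ d * Mq ^ (2 * d) * Pq ^ (2 * 18)) :
    dmin ≤ Real.exp (-(6 / 1000 * (n * Real.log Mq + d * Real.log M))) := by
  set LM := Real.log M with hLM
  set lq := Real.log Mq with hlq
  have hM1 : (1 : ℝ) < M := lt_of_lt_of_le (by norm_num) hM2
  have hLM0 : 0 < LM := Real.log_pos hM1
  have hLM2 : 200 * Real.log 2 ≤ LM := by
    have h := Real.log_le_log (by positivity) hM2
    rw [Real.log_pow] at h; push_cast at h; linarith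
  have hd1' : (1 : ℝ) ≤ d := by exact_mod_cast hd1
  have hdn' : (d : ℝ) ≤ n := by exact_mod_cast hdn
  have hlq0 : 0 ≤ lq := Real.log_nonneg hMq1
  have hMq0 : 0 < Mq := by linarith
  have hlogd : Real.log d ≤ LM := by
    refine (Real.log_le_log (by linarith) ?_).trans (Real.log_le_log (by positivity) hnM)
    linarith
  -- everything as exponentials
  have e1 : (2 : ℝ) ^ (2 * d * 18) ≤ Real.exp (36 * d * (LM / 200)) := by
    rw [← Real.exp_log (by positivity : (0 : ℝ) < 2 ^ (2 * d * 18)), Real.log_pow]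
    apply Real.exp_le_exp.2
    have h2 : Real.log 2 ≤ LM / 200 := by linarith
    rw [show ((2 * d * 18 : ℕ) : ℝ) * Real.log 2 = (36 * d) * Real.log 2 by push_cast; ring]
    exact mul_le_mul_of_nonneg_left h2 (by positivity)
  have e2 : (d : ℝ) ^ d ≤ Real.exp (d * LM) := by
    rw [← Real.exp_log (by positivity : (0 : ℝ) < (d : ℝ) ^ d), Real.log_pow]
    exact Real.exp_le_exp.2 (mul_le_mul_of_nonneg_left hlogd (by positivity))
  have e3 : Mq ^ (2 * d) = Real.exp (2 * d * lq) := by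
    rw [hlq, show (2 * (d : ℝ)) * Real.log Mq = ((2 * d : ℕ) : ℝ) * Real.log Mq by push_cast; ring,
      ← Real.log_pow, Real.exp_log (by positivity)]
  have e4 : Pq ^ (2 * 18) ≤ Real.exp (-(36 * (113 / 1000)) * (d * LM + n * lq)) := by
    calc Pq ^ (2 * 18) ≤ (Real.exp (-(113 / 1000) * (d * LM + n * lq))) ^ (2 * 18) :=
          pow_le_pow_left₀ hPq hqlt _
      _ = _ := by rw [← Real.exp_nat_mul]; push_cast; ring_nf
  have hmain : dmin ^ (18 * (18 + 1)) ≤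
      Real.exp (-(6 / 1000 * (n * lq + d * LM))) ^ (18 * (18 + 1)) := by
    calc dmin ^ (18 * (18 + 1))
        ≤ 2 ^ (2 * d * 18) * (d : ℝ) ^ d * Mq ^ (2 * d) * Pq ^ (2 * 18) := hA8
      _ ≤ Real.exp (36 * d * (LM / 200)) * Real.exp (d * LM) * Real.exp (2 * d * lq) *
            Real.exp (-(36 * (113 / 1000)) * (d * LM + n * lq)) := by
          rw [e3]; gcongr
      _ = Real.exp (36 * d * (LM / 200) + d * LM + 2 * d * lq +
            -(36 * (113 / 1000)) * (d * LM + n * lq)) := by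
          rw [Real.exp_add, Real.exp_add, Real.exp_add]
      _ ≤ Real.exp ((18 * (18 + 1) : ℕ) * -(6 / 1000 * (n * lq + d * LM))) := by
          apply Real.exp_le_exp.2
          have h1 : d * lq ≤ n * lq := mul_le_mul_of_nonneg_right hdn' hlq0
          have h2 : 0 ≤ (d : ℝ) * LM := mul_nonneg (by positivity) hLM0.le
          have h3 : 0 ≤ (n : ℝ) * lq := mul_nonneg (by positivity) hlq0
          push_cast
          linarith
      _ = _ := by rw [Real.exp_nat_mul]
  exact (pow_le_pow_iff_left₀ hdmin (Real.exp_pos _).le (by norm_num)).1 hmain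

/-- **Bugeaud 2004, Theorem 8.11 (Diaz 1997)**, discharged: the printed proof (Lemma 8.1 with
`H = M (n+1)^{-1/2}`, Landau's inequality `M(P) ≤ √(n+1) H(P)` (Lemma A.2), factorisation into
irreducible integer polynomials and the averaging step (8.22), Lemma A.8 (A.25) with `ℓ = 18`,
and `log 2 ≤ (log M)/200`). [cite: Bugeaud2004, Thm 8.11] -/
theorem Bugeaud2004_thm_8_11_holds : Bugeaud2004_thm_8_11 := by
  intro ξ n M hn hnM hξM
  -- basic sizes
  have hM4 : (4 : ℝ) ^ 100 ≤ M :=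
    le_trans (pow_le_pow_left₀ (by norm_num) (by linarith [norm_nonneg ξ]) 100) hξM
  have hM2 : (2 : ℝ) ^ 200 ≤ M := le_trans (by norm_num) hM4
  have hM0 : (0 : ℝ) < M := by linarith
  set LM := Real.log M with hLM
  have hLM0 : 0 < LM := Real.log_pos (by linarith)
  -- Steps 1–2
  obtain ⟨P₀, hP₀0, hP₀deg, hMP₀, hP₀small⟩ := exists_int_poly_mahlerMeasure_le ξ n M hn hnM hξM
  set p₀ := P₀.map (Int.castRingHom ℂ) with hp₀
  have hp₀0 : p₀ ≠ 0 := (Polynomial.map_ne_zero_iff (Int.cast_injective (α := ℂ))).2 hP₀0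
  -- Step 3: the averaging step gives an irreducible factor `q` of positive degree
  have hw : ‖aeval ξ P₀‖ < Real.exp (-(113 / 1000) * (P₀.natDegree * Real.log M +
      n * Real.log (P₀.map (Int.castRingHom ℂ)).mahlerMeasure)) := by
    refine lt_of_le_of_lt hP₀small (Real.exp_lt_exp.2 ?_)
    have h1 : (P₀.natDegree : ℝ) ≤ n := by exact_mod_cast hP₀deg
    have h2 : Real.log p₀.mahlerMeasure ≤ LM :=
      Real.log_le_log (mahlerMeasure_pos_of_ne_zero hp₀0) hMP₀
    have h3 : 0 ≤ Real.log p₀.mahlerMeasure :=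
      Real.log_nonneg (one_le_mahlerMeasure_map P₀ hP₀0)
    rw [← hp₀]
    have k1 : (P₀.natDegree : ℝ) * LM ≤ n * LM := mul_le_mul_of_nonneg_right h1 hLM0.le
    have k2 : (n : ℝ) * Real.log p₀.mahlerMeasure ≤ n * LM :=
      mul_le_mul_of_nonneg_left h2 (by positivity)
    have k3 : 0 < (n : ℝ) * LM := mul_pos (by positivity) hLM0
    linarith
  obtain ⟨q, hqirr, hqP₀, hqdeg, hqlt⟩ := exists_irreducible_factor_lt_weight ξ n M P₀ hP₀0 hw
  set pq := q.map (Int.castRingHom ℂ) with hpq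
  have hq0 : q ≠ 0 := hqirr.ne_zero
  have hpq0 : pq ≠ 0 := (Polynomial.map_ne_zero_iff (Int.cast_injective (α := ℂ))).2 hq0
  have hsep : pq.Separable := separable_map_of_irreducible q hqirr hqdeg
  have hdq : q.natDegree ≤ n := (natDegree_le_of_dvd hqP₀ hP₀0).trans hP₀deg
  have hMq : pq.mahlerMeasure ≤ M := (mahlerMeasure_map_le_of_dvd hqP₀ hP₀0).trans hMP₀
  have hMq1 : 1 ≤ pq.mahlerMeasure := one_le_mahlerMeasure_map q hq0
  -- Step 4: the closest root `α` of `q` and Lemma A.8 with `ℓ = 18`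
  have hne : (pq.roots.toFinset).Nonempty := by
    rw [Multiset.toFinset_nonempty, ← Multiset.card_pos,
      ← (IsAlgClosed.splits pq).natDegree_eq_card_roots,
      natDegree_map_eq_of_injective Int.cast_injective]
    exact hqdeg
  obtain ⟨α, hα, hαmin⟩ := Finset.exists_min_image _ (fun β => ‖ξ - β‖) hne
  rw [Multiset.mem_toFinset] at hα
  have hαmin' : ∀ β ∈ pq.roots, ‖ξ - α‖ ≤ ‖ξ - β‖ := fun β hβ =>
    hαmin β (Multiset.mem_toFinset.2 hβ)
  have hwq1 : Real.exp (-(113 / 1000) * (q.natDegree * Real.log M +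
      n * Real.log (q.map (Int.castRingHom ℂ)).mahlerMeasure)) ≤ 1 := by
    rw [Real.exp_le_one_iff, ← hpq]
    have h1 : 0 ≤ Real.log pq.mahlerMeasure := Real.log_nonneg hMq1
    have h2 : 0 ≤ (q.natDegree : ℝ) * LM + n * Real.log pq.mahlerMeasure :=
      add_nonneg (mul_nonneg (Nat.cast_nonneg _) hLM0.le) (mul_nonneg (Nat.cast_nonneg _) h1)
    nlinarith
  have hqsmall : ‖aeval ξ q‖ ≤ 1 := (hqlt.le).trans hwq1
  have hA8 := norm_sub_root_pow_le q hqdeg hsep ξ α hα hαmin' hqsmall 18 (by norm_num)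
  -- Step 5
  refine ⟨α, q, hqirr, ?_, hdq, hMq, ?_⟩
  · have := (mem_roots hpq0).1 hα
    rwa [IsRoot, hpq, eval_map, ← algebraMap_int_eq, ← aeval_def] at this
  · exact dist_le_of_root_distance_bound ‖ξ - α‖ ‖aeval ξ q‖ pq.mahlerMeasure M q.natDegree n
      (norm_nonneg _) (norm_nonneg _) hqdeg hdq hnM hM2 hMq1 hqlt.le hA8

end Literature.NumberTheory.DiophantineApproximation
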